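import Literature.AlgebraicGeometry.Resolution.CoordinateBlowupTower
import HarnessLib

/-!
# Values of the chart coordinates of a coordinate blow-up tower on an integral subscheme: proper transforms of its equations vanish on its strict transform (Hu 2025, §5.1, §7, §8)

Topic: `Literature/AlgebraicGeometry/Resolution`. Continuation of `CoordinateBlowupTower.lean`
(a standard chart of a tower of coordinate blow-ups of `𝔸^σ_S` is a word `w` of steps; its ring
is `S[X_σ]` at every level; `towerSubst w` is the total transform and `towerProperTransform w` the
iterated proper transform, `π*_w f = (exceptional monomial) · f_𝔙`). In Y. Hu, *Universal
characteristic-free resolution of singularities, I* (arXiv:2507.21400), the singular model `𝒱`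
and the Γ-schemes are carried up the tower as STRICT transforms (`Ṽ_{ϑ[k]}`, `Ṽ_℘`, `Ṽ_ℓ`, `Z†`;
§5.3, §7 "the closure of the preimage of the iso-locus"), while the EQUATIONS are carried up as
proper transforms of the individual governing binomials and linearized Plücker relations
(Def. 5.4, Prop. 5.12 ff.); the link used in §8 is only the containment "`B_𝔙`, `L_{𝔙,F}` vanish on
`Ṽ ∩ 𝔙`" (the reverse inclusion being supplied locally by the Jacobian/dimension squeeze, §8.4).

This file proves that containment in its natural algebraic form. An integral closed subscheme
`V ⊆ 𝔸^σ_S` meeting the open part is recorded by the VALUES `v : σ → K` of the coordinates in its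
function field `K` (so its ideal is `ker (aeval v)`); on the chart `w` of the tower, the strict
transform `Ṽ ∩ 𝔙_w` has coordinates with values `towerVal w v` (`y_j = y'_j / y'_{i₀}` on the
centre variables, Prop. 5.3), PROVIDED the chart meets `Ṽ`, i.e. no exceptional value vanishes
along the way (`TowerNondeg w v`; otherwise "the divisor does not intersect the chart",
Prop. 5.11). PROVED:

* `aeval_stepVal_coordBlowupSubst`, `aeval_towerVal_towerSubst` — **pull-back compatibility**
  `(towerVal w v)(π*_w f) = v(f)`: the chart map restricted to `Ṽ` is the birational structure
  map;
* `aeval_towerVal_towerProperTransform_eq_zero` — **if `f` vanishes on `V` then its proper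
  transform `f_𝔙` vanishes on `Ṽ ∩ 𝔙_w`** (`v(f) = 0 ⇒ (towerVal w v)(f_𝔙) = 0`), because the
  exceptional factor has non-zero value (`aeval_towerVal_towerExcFactor_ne_zero`);
* `towerStrictChartRing w v := (aeval (towerVal w v)).range` — the coordinate ring of `Ṽ ∩ 𝔙_w`
  as a subring of `K` (an integral domain, `towerStrictChartRing.instIsDomain`), with
  `towerProperTransform_mem_ker` : `f ∈ ker (aeval v) → f_𝔙 ∈ ker (aeval (towerVal w v))` — the
  surjection `S[X_σ] ⧸ (f_𝔙 : f ∈ I(V)) ↠ 𝒪(Ṽ ∩ 𝔙_w)` on which `JacobianDimensionSqueeze` operates.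

Everything is proved; no named facts (D-0026).

## References

* Y. Hu, *Universal Characteristic-free Resolution of Singularities, I*, arXiv:2507.21400 (2025),
  §5.1 Prop. 5.3, Def. 5.4, §5.3–5.4 Prop. 5.11–5.12, §7.1, §8.4 (theorem numbers of the arXiv v1
  TeX source). [Hu2025]
* The Stacks Project, Tag 080C (strict transform), Tag 080E (strict transform of an integral
  scheme is its blow-up). [StacksProject]
-/

noncomputable section

open MvPolynomial

namespace Literature.AlgebraicGeometry.Resolution

universe u v w

variable (S : Type u) [CommRing S] {σ : Type v} {K : Type w} [Field K] [Algebra S K]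

/-! ### Values of the new coordinates after one step and along a word -/

open Classical in
/-- **Values of the chart coordinates after one blow-up step** `(A, i₀)`: `y_j = y'_j / y'_{i₀}` for
`j ∈ A ∖ i₀` (the proper transforms), `ζ = y'_{i₀}` and the other coordinates unchanged
(Prop. 5.3 read on an integral subscheme through its function field). [cite: Hu2025, §5.1 Prop. 5.3] -/
def stepVal (st : CoordBlowupStep σ) (v : σ → K) : σ → K :=
  fun j => if j ∈ st.A ∧ j ≠ st.i₀ then v j / v st.i₀ else v j

/-- **Values of the chart coordinates along the word `w`** (head = first blow-up). [cite: Hu2025, §5.1 Prop. 5.3 and §5.4 Prop. 5.11] -/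
def towerVal : List (CoordBlowupStep σ) → (σ → K) → (σ → K)
  | [], v => v
  | st :: w, v => towerVal w (stepVal st v)

/-- **The chart meets the strict transform**: no exceptional value vanishes along the word
(otherwise `Ṽ ∩ 𝔙_w = ∅` — "the divisor does not intersect the chart"). [cite: Hu2025, §5.4 Prop. 5.11] -/
def TowerNondeg : List (CoordBlowupStep σ) → (σ → K) → Prop
  | [], _ => True
  | st :: w, v => v st.i₀ ≠ 0 ∧ TowerNondeg w (stepVal st v)

/-- The empty word changes nothing. [folklore] -/
@[simp] theorem towerVal_nil (v : σ → K) : towerVal ([] : List (CoordBlowupStep σ)) v = v := rfl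

/-- Unfolding `towerVal` along `st :: w`. [folklore] -/
@[simp] theorem towerVal_cons (st : CoordBlowupStep σ) (w : List (CoordBlowupStep σ)) (v : σ → K) :
    towerVal (st :: w) v = towerVal w (stepVal st v) := rfl

/-- The empty word is non-degenerate. [folklore] -/
@[simp] theorem towerNondeg_nil (v : σ → K) : TowerNondeg ([] : List (CoordBlowupStep σ)) v := trivial

/-- Unfolding `TowerNondeg` along `st :: w`. [folklore] -/
@[simp] theorem towerNondeg_cons (st : CoordBlowupStep σ) (w : List (CoordBlowupStep σ)) (v : σ → K) :
    TowerNondeg (st :: w) v ↔ v st.i₀ ≠ 0 ∧ TowerNondeg w (stepVal st v) := Iff.rfl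

/-- `stepVal` on the exceptional coordinate: `ζ = y'_{i₀}`. [cite: Hu2025, §5.1 Prop. 5.3] -/
@[simp] theorem stepVal_self (st : CoordBlowupStep σ) (v : σ → K) : stepVal st v st.i₀ = v st.i₀ := by
  simp [stepVal]

/-- `stepVal` on a centre coordinate `j ≠ i₀`: `y_j = y'_j / y'_{i₀}`. [cite: Hu2025, §5.1 Prop. 5.3] -/
theorem stepVal_of_mem_of_ne (st : CoordBlowupStep σ) (v : σ → K) {j : σ} (hj : j ∈ st.A) (hne : j ≠ st.i₀) :
    stepVal st v j = v j / v st.i₀ := by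
  simp [stepVal, hj, hne]

/-- `stepVal` off the centre coordinates: unchanged. [cite: Hu2025, §5.1 Prop. 5.3] -/
theorem stepVal_of_not_mem (st : CoordBlowupStep σ) (v : σ → K) {j : σ} (hj : j ∉ st.A) :
    stepVal st v j = v j := by
  simp [stepVal, hj]

/-! ### Pull-back compatibility -/

/-- **One step: `(stepVal v)(π* f) = v(f)`** when `v(y'_{i₀}) ≠ 0`. [cite: Hu2025, §5.1 Prop. 5.3 and Def. 5.4] -/
theorem aeval_stepVal_coordBlowupSubst (st : CoordBlowupStep σ) {v : σ → K} (hv : v st.i₀ ≠ 0)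
    (f : MvPolynomial σ S) :
    aeval (stepVal st v) (coordBlowupSubst S st.A st.i₀ f) = aeval v f := by
  suffices h : (aeval (stepVal st v)).comp (coordBlowupSubst S st.A st.i₀) = aeval v from
    AlgHom.congr_fun h f
  refine MvPolynomial.algHom_ext fun j => ?_
  rw [AlgHom.comp_apply, aeval_X]
  by_cases hj : j ∈ st.A
  · by_cases hne : j = st.i₀
    · subst hne
      rw [coordBlowupSubst_X_self, aeval_X, stepVal_self]
    · rw [coordBlowupSubst_X_of_mem_of_ne S st.A st.i₀ hj hne, map_mul, aeval_X, aeval_X, stepVal_self,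
        stepVal_of_mem_of_ne st v hj hne, mul_div_cancel₀ _ hv]
  · rw [coordBlowupSubst_X_of_not_mem S st.A st.i₀ hj, aeval_X, stepVal_of_not_mem st v hj]

/-- **Along a word: `(towerVal w v)(π*_w f) = v(f)`** on a chart meeting the strict transform —
the chart map restricted to `Ṽ ∩ 𝔙_w` is the (birational) structure map to `V`.
[cite: Hu2025, §5.1 Def. 5.4 and §7.1] -/
theorem aeval_towerVal_towerSubst (w : List (CoordBlowupStep σ)) {v : σ → K} (hv : TowerNondeg w v)
    (f : MvPolynomial σ S) :
    aeval (towerVal w v) (towerSubst S w f) = aeval v f := by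
  induction w generalizing v f with
  | nil => rfl
  | cons st w ih =>
    rw [towerSubst_cons, towerVal_cons, ih hv.2, aeval_stepVal_coordBlowupSubst S st hv.1]

/-- A monomial with coefficient `1` has non-zero value as soon as all the coordinates occurring in
it have non-zero values. [folklore] -/
theorem aeval_monomial_one_ne_zero {v : σ → K} {d : σ →₀ ℕ} (hv : ∀ j ∈ d.support, v j ≠ 0) :
    aeval v (monomial d (1 : S)) ≠ 0 := by
  rw [aeval_monomial, map_one, one_mul, Finsupp.prod]
  exact Finset.prod_ne_zero_iff.mpr fun j hj => pow_ne_zero _ (hv j hj)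

/-- **The exceptional values never vanish on a chart meeting `Ṽ`**: the value of `π*_w (X_j)` is
non-zero whenever `v(X_j) ≠ 0`… more precisely, pull-back compatibility gives
`(towerVal w v)(π*_w X_j) = v_j`. [cite: Hu2025, §5.4 Prop. 5.11] -/
theorem aeval_towerVal_towerSubst_X (w : List (CoordBlowupStep σ)) {v : σ → K} (hv : TowerNondeg w v) (j : σ) :
    aeval (towerVal w v) (towerSubst S w (X j)) = v j := by
  rw [aeval_towerVal_towerSubst S w hv, aeval_X]

/-- **The accumulated exceptional factor has non-zero value on a chart meeting `Ṽ`.**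
[cite: Hu2025, §5.1 Def. 5.4 and §5.4 Prop. 5.11] -/
theorem aeval_towerVal_towerExcFactor_ne_zero (w : List (CoordBlowupStep σ)) {v : σ → K}
    (hv : TowerNondeg w v) (f : MvPolynomial σ S) :
    aeval (towerVal w v) (towerExcFactor S w f) ≠ 0 := by
  induction w generalizing v f with
  | nil => simp
  | cons st w ih =>
    rw [towerExcFactor_cons, map_mul, towerVal_cons, map_pow, map_pow, aeval_towerVal_towerSubst_X S w hv.2,
      stepVal_self]
    exact mul_ne_zero (pow_ne_zero _ hv.1) (ih hv.2 _)

/-- **Proper transforms of the equations of `V` vanish on its strict transform**: if `v(f) = 0`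
then `(towerVal w v)(f_𝔙) = 0` on every chart `𝔙_w` meeting `Ṽ` — since
`v(f) = (towerVal w v)(π*_w f) = (exceptional value ≠ 0) · (towerVal w v)(f_𝔙)`.
[cite: Hu2025, §5.1 Def. 5.4, §5.4 Prop. 5.12 and §8.4] -/
theorem aeval_towerVal_towerProperTransform_eq_zero (w : List (CoordBlowupStep σ)) {v : σ → K}
    (hv : TowerNondeg w v) {f : MvPolynomial σ S} (hf : aeval v f = 0) :
    aeval (towerVal w v) (towerProperTransform S w f) = 0 := by
  have h := aeval_towerVal_towerSubst S w hv f
  rw [towerSubst_eq_towerExcFactor_mul, map_mul, hf] at h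
  exact (mul_eq_zero.mp h).resolve_left (aeval_towerVal_towerExcFactor_ne_zero S w hv f)

/-- Conversely the proper transform vanishes on `Ṽ ∩ 𝔙_w` ONLY IF `f` vanishes on `V`.
[cite: Hu2025, §5.1 Def. 5.4] -/
theorem aeval_towerVal_towerProperTransform_eq_zero_iff (w : List (CoordBlowupStep σ)) {v : σ → K}
    (hv : TowerNondeg w v) (f : MvPolynomial σ S) :
    aeval (towerVal w v) (towerProperTransform S w f) = 0 ↔ aeval v f = 0 := by
  refine ⟨fun h => ?_, aeval_towerVal_towerProperTransform_eq_zero S w hv⟩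
  rw [← aeval_towerVal_towerSubst S w hv f, towerSubst_eq_towerExcFactor_mul, map_mul, h, mul_zero]

/-! ### The coordinate ring of `Ṽ ∩ 𝔙_w` inside the function field -/

/-- **The coordinate ring of the strict transform on the chart `𝔙_w`**: the `S`-subalgebra of the
function field `K` generated by the values of the chart coordinates (for `w = []`, that of `V`
itself). [cite: Hu2025, §7.1 and §5.3] [cite: StacksProject, Tag 080E] -/
def towerStrictChartRing (w : List (CoordBlowupStep σ)) (v : σ → K) : Subalgebra S K :=
  (aeval (towerVal w v) : MvPolynomial σ S →ₐ[S] K).range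

/-- `Ṽ ∩ 𝔙_w` is integral (a subring of a field). [cite: StacksProject, Tag 080E] -/
instance towerStrictChartRing.instIsDomain (w : List (CoordBlowupStep σ)) (v : σ → K) :
    IsDomain (towerStrictChartRing S w v) :=
  inferInstance

/-- **Birationality at the level of rings of functions**: the ring of `V` sits inside that of
`Ṽ ∩ 𝔙_w` (inside `K`): `v(f) = (towerVal w v)(π*_w f)`. [cite: Hu2025, §7.1] -/
theorem towerStrictChartRing_nil_le (w : List (CoordBlowupStep σ)) {v : σ → K} (hv : TowerNondeg w v) :
    towerStrictChartRing S [] v ≤ towerStrictChartRing S w v := by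
  rintro _ ⟨f, rfl⟩
  exact ⟨towerSubst S w f, aeval_towerVal_towerSubst S w hv f⟩

/-- **The equations available on the chart**: `f ∈ I(V) ⇒ f_𝔙 ∈ ker (S[X_σ] → 𝒪(Ṽ ∩ 𝔙_w))` — so
`S[X_σ] ⧸ (f_𝔙 : f ∈ I(V))` surjects onto the coordinate ring of `Ṽ ∩ 𝔙_w`, the setting of the
Jacobian/dimension squeeze of §8.4. [cite: Hu2025, §8.4] -/
theorem towerProperTransform_mem_ker (w : List (CoordBlowupStep σ)) {v : σ → K} (hv : TowerNondeg w v)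
    {f : MvPolynomial σ S} (hf : f ∈ RingHom.ker (aeval v : MvPolynomial σ S →ₐ[S] K)) :
    towerProperTransform S w f ∈ RingHom.ker (aeval (towerVal w v) : MvPolynomial σ S →ₐ[S] K) := by
  rw [RingHom.mem_ker] at hf ⊢
  exact aeval_towerVal_towerProperTransform_eq_zero S w hv hf

end Literature.AlgebraicGeometry.Resolution

end
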